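import Mathlib.Topology.Algebra.Category.ProfiniteGrp.Basic
import Mathlib.GroupTheory.Commensurable
import Mathlib.Algebra.Group.Subgroup.Pointwise
import Mathlib.Topology.Algebra.Group.Quotient
import Literature.AnabelianGeometry.AbsoluteAnabelian.ProfiniteTerminology

/-!
# [AbsTopII] §1 Prop 1.3 (Basic properties of inertia and decomposition groups)

S. Mochizuki, *Topics in Absolute Anabelian Geometry II* (2013) [AbsTopII] §1 "A Combinatorial
Analogue of Stable Polycurves", Def 1.2 (ii) and Prop 1.3 pp. 10–12 (manuscript pagination, lit
key paper:url-585b8d0ad0d9).  Setting (Example 1.1, Def 1.2 (ii)): a [pro-`Σ`] DPSC-extension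
`1 → Π_𝔾 → Π_H = Π_𝔾 ⋊^{out} H → H → 1` attached to a stable log curve over a log point, with
its inertia subgroup `I ⊆ H` (`Π_I := Π_𝔾 ⋊^{out} I`), and the verticial / edge-like subgroups
`Π_v`, `Π_e ⊆ Π_𝔾` of the semi-graph of anabelioids of pro-`Σ` PSC-type `𝔾`; Def 1.2 (ii)
DEFINES the decomposition groups `D_v := N_{Π_H}(Π_v)`, `D_e := N_{Π_H}(Π_e)` and inertia groups
`I_v := Z_{Π_I}(Π_v)`, `I_e := Z_{Π_I}(Π_e)` (node), `I_e := Π_e` (cusp).  [IUTchI] pp. 45, 49,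
50 cite Prop 1.3 (iv).

Typing: the PSC / DPSC vocabulary (semi-graphs of anabelioids, [CombGC], [SemiAnbd]) is
abc-iut-L3's (`Literature.AnabelianGeometry.SemiGraphs`, pending); here the purely
group-theoretic layer is typed over an abstract data structure `DPSCData` (TODO-merge:
abc-iut-L3-t4 `PSCFundamentalGroup` — the fields `PiG`, `vertSub`, `edge…` are to be instantiated
from it) with REAL definitions of `D_v, I_v, D_e, I_e` exactly as in Def 1.2 (ii), and Prop 1.3
(iii) [first clause], (iv), (v), (vi), (vii), (ix) as PREDICATES (the printed conclusions; they
hold for data arising from a stable log curve — the model-relative comparison is not asserted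
here).  Deliberately NOT typed: (i), (ii) (`I_e ≅ Ẑ^Σ`, `Ẑ^Σ × Ẑ^Σ`, the `Σ`-index `i^Σ_e`),
(viii), (x) (log points), and the refined "for appropriate choices of conjugates" clauses of
(iv) beyond the trichotomy and its "in particular".
-/

noncomputable section

open scoped Pointwise

universe u

namespace Literature.AnabelianGeometry.AbsoluteAnabelian

/-- Abstract DPSC data ([AbsTopII] Def 1.2 (ii)): the profinite group `Π_H`, its closed normal
subgroup `Π_𝔾` (the PSC-fundamental group), the normal subgroup `Π_I ⊇ Π_𝔾` (preimage of the
inertia subgroup `I ⊆ H`), the vertices / nodes / cusps of the underlying semi-graph `𝔾` with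
chosen verticial and edge-like subgroups `Π_v, Π_e ⊆ Π_𝔾` and the incidence relation.
TODO-merge: abc-iut-L3-t4 (PSC-fundamental groups of [CombGC]/[SemiAnbd]).
[cite: MochizukiAbsTopII2013, Def 1.2 (ii) p.10] -/
structure DPSCData : Type (u + 1) where
  /-- `Π_H` -/
  PiH : ProfiniteGrp.{u}
  /-- `Π_𝔾 ⊆ Π_H` -/
  PiG : Subgroup PiH
  /-- `Π_𝔾` is normal -/
  normal_PiG : PiG.Normal
  /-- `Π_𝔾` is closed -/
  isClosed_PiG : IsClosed (PiG : Set PiH)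
  /-- `Π_I ⊆ Π_H`, the preimage of the inertia subgroup `I ⊆ H` -/
  PiI : Subgroup PiH
  /-- `Π_𝔾 ⊆ Π_I` -/
  PiG_le_PiI : PiG ≤ PiI
  /-- `Π_I` is normal (the inertia subgroup `I ⊆ H` has normal image) -/
  normal_PiI : PiI.Normal
  /-- vertices of `𝔾` (irreducible components) -/
  Vert : Type u
  /-- nodes of `𝔾` (closed edges) -/
  Node : Type u
  /-- cusps of `𝔾` (open edges) -/
  Cusp : Type u
  /-- a verticial subgroup `Π_v ⊆ Π_𝔾` for each vertex (a chosen conjugate) -/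
  vertSub : Vert → Subgroup PiH
  /-- `Π_v ≤ Π_𝔾` -/
  vertSub_le : ∀ v, vertSub v ≤ PiG
  /-- a nodal edge-like subgroup `Π_e ⊆ Π_𝔾` for each node -/
  nodeSub : Node → Subgroup PiH
  /-- `Π_e ≤ Π_𝔾` -/
  nodeSub_le : ∀ e, nodeSub e ≤ PiG
  /-- a cuspidal edge-like subgroup `Π_e ⊆ Π_𝔾` for each cusp -/
  cuspSub : Cusp → Subgroup PiH
  /-- `Π_e ≤ Π_𝔾` -/
  cuspSub_le : ∀ e, cuspSub e ≤ PiG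
  /-- the node `e` abuts to the vertex `v` -/
  nodeAbuts : Node → Vert → Prop
  /-- the vertex to which the cusp `e` abuts -/
  cuspVert : Cusp → Vert

namespace DPSCData

variable (X : DPSCData.{u})

/-- `D_v := N_{Π_H}(Π_v)`, the decomposition group of the vertex `v` (Def 1.2 (ii)).
[cite: MochizukiAbsTopII2013, Def 1.2 (ii) p.10] -/
def Dv (v : X.Vert) : Subgroup X.PiH := Subgroup.normalizer (X.vertSub v : Set X.PiH)

/-- `I_v := Z_{Π_I}(Π_v)`, the inertia group of the vertex `v` (Def 1.2 (ii)).
[cite: MochizukiAbsTopII2013, Def 1.2 (ii) p.10] -/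
def Iv (v : X.Vert) : Subgroup X.PiH := Subgroup.centralizer (X.vertSub v : Set X.PiH) ⊓ X.PiI

/-- `D_e := N_{Π_H}(Π_e)` for a node `e` (Def 1.2 (ii)). [cite: MochizukiAbsTopII2013, Def 1.2 (ii) p.10] -/
def DvNode (e : X.Node) : Subgroup X.PiH := Subgroup.normalizer (X.nodeSub e : Set X.PiH)

/-- `I_e := Z_{Π_I}(Π_e)` for a node `e` (Def 1.2 (ii)). [cite: MochizukiAbsTopII2013, Def 1.2 (ii) p.10] -/
def IvNode (e : X.Node) : Subgroup X.PiH := Subgroup.centralizer (X.nodeSub e : Set X.PiH) ⊓ X.PiI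

/-- `D_e := N_{Π_H}(Π_e)` for a cusp `e` (Def 1.2 (ii)). [cite: MochizukiAbsTopII2013, Def 1.2 (ii) p.10] -/
def DvCusp (e : X.Cusp) : Subgroup X.PiH := Subgroup.normalizer (X.cuspSub e : Set X.PiH)

/-- `I_e := Π_e = D_e ∩ Π_𝔾` for a cusp `e` (Def 1.2 (ii)). [cite: MochizukiAbsTopII2013, Def 1.2 (ii) p.10] -/
def IvCusp (e : X.Cusp) : Subgroup X.PiH := X.cuspSub e

/-- Vertices `v, v'` are *adjacent*: "there exists a node `e` that abuts to `v, v'`".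
[cite: MochizukiAbsTopII2013, Prop 1.3 (iv) p.12] -/
def Adjacent (v v' : X.Vert) : Prop := ∃ e : X.Node, X.nodeAbuts e v ∧ X.nodeAbuts e v'

/-- [AbsTopII] Prop 1.3 (iii), first clause, as a predicate: "we have a natural isomorphism
`I_v ≅ I`" — the projection `Π_I → Π_I/Π_𝔾 = I` restricted to `I_v` is injective with image all
of `I`. [cite: MochizukiAbsTopII2013, Prop 1.3 (iii) p.11] -/
def Prop13iii : Prop :=
  ∀ v : X.Vert, X.Iv v ⊓ X.PiG = ⊥ ∧ X.Iv v ⊔ X.PiG = X.PiI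

/-- [AbsTopII] Prop 1.3 (iv), the trichotomy and its "in particular", as a predicate: "Let
`v, v'` be vertices of `𝔾`. If `D_v ∩ D_{v'} ∩ Π_I ≠ {1}`, then one of the following three
[mutually exclusive] properties holds: (1) `v = v'`; (2) `v` and `v'` are distinct, but adjacent;
(3) `v` and `v'` are distinct and non-adjacent, but there exists a vertex `v'' ≠ v, v'` …
adjacent to `v` and `v'` … In particular, `I_v ∩ I_{v'} ≠ {1}` implies that `v = v'`."
(typed for all `Π_H`-conjugates of the chosen `D_{v'}`, `I_{v'}`).  Cited by [IUTchI] pp. 45,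
49, 50.  SUPERSEDED — TOO STRONG AS TYPED (finding F-L4t6g5-1, abc-iut-L4-t6, kernel
certificates `AbsTopII/Prop13ConjugacyScope.lean`): print determines `Π_{v'}` only "up to
conjugation in `Π_𝔾`" (Def 1.2 (ii) p. 10), whereas a conjugate by `g ∈ Π_H` lying over an
`h ∈ H` whose action `ρ_H(h)` MOVES `v'` is a verticial subgroup of the moved vertex, so this
predicate fails for vertex-moving `ρ_H` (admissible construction data); the faithful statement
is `Prop13iv'` below (conjugating element in `Π_𝔾`), which this one trivially implies
(restriction of the quantifier to `Π_𝔾 ⊆ Π_H`).  Kept for the record and for importers.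
[cite: MochizukiAbsTopII2013, Prop 1.3 (iv) p.11] -/
def Prop13iv : Prop :=
  (∀ (v v' : X.Vert) (g : X.PiH), X.Dv v ⊓ MulAut.conj g • X.Dv v' ⊓ X.PiI ≠ ⊥ →
      v = v' ∨ (v ≠ v' ∧ X.Adjacent v v') ∨
        (v ≠ v' ∧ ¬ X.Adjacent v v' ∧ ∃ v'' : X.Vert, v'' ≠ v ∧ v'' ≠ v' ∧
          X.Adjacent v v'' ∧ X.Adjacent v'' v')) ∧
    ∀ (v v' : X.Vert) (g : X.PiH), X.Iv v ⊓ MulAut.conj g • X.Iv v' ≠ ⊥ → v = v'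

/-- [AbsTopII] Prop 1.3 (v) as a predicate: "`D_v = C_{Π_H}(I_v) = N_{Π_H}(I_v)` is commensurably
terminal in `Π_H`; … `D_v ∩ Π_𝔾 = Π_v` is commensurably terminal in `Π_𝔾`" (the middle clause
on `D_v ∩ Π_I` is not typed). [cite: MochizukiAbsTopII2013, Prop 1.3 (v) p.12] -/
def Prop13v : Prop :=
  ∀ v : X.Vert,
    X.Dv v = Subgroup.Commensurable.commensurator (X.Iv v) ∧
      X.Dv v = Subgroup.normalizer (X.Iv v : Set X.PiH) ∧
      IsCommensurablyTerminal (X.Dv v) ∧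
      X.Dv v ⊓ X.PiG = X.vertSub v ∧
      IsCommensurablyTerminal ((X.vertSub v).subgroupOf X.PiG)

/-- [AbsTopII] Prop 1.3 (vi) as a predicate: "the image of `D_v` in `H` is open; on the other
hand, if `𝔾` has more than one vertex, then `D_v` is not open in `Π_H`" (`H = Π_H/Π_𝔾` with the
quotient topology). [cite: MochizukiAbsTopII2013, Prop 1.3 (vi) p.12] -/
def Prop13vi : Prop :=
  haveI := X.normal_PiG
  ∀ v : X.Vert, IsOpen (((X.Dv v).map (QuotientGroup.mk' X.PiG) : Subgroup (X.PiH ⧸ X.PiG)) :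
      Set (X.PiH ⧸ X.PiG)) ∧
    ((∃ w : X.Vert, w ≠ v) → ¬ IsOpen (X.Dv v : Set X.PiH))

/-- [AbsTopII] Prop 1.3 (vii) as a predicate: "Let `e` be an edge of `𝔾`. Then
`D_e = C_{Π_H}(Π_e) = N_{Π_H}(Π_e)` is commensurably terminal in `Π_H`. If `e` is a node, then
`I_e = D_e ∩ Π_I`." [cite: MochizukiAbsTopII2013, Prop 1.3 (vii) p.12] -/
def Prop13vii : Prop :=
  (∀ e : X.Node, X.DvNode e = Subgroup.Commensurable.commensurator (X.nodeSub e) ∧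
      IsCommensurablyTerminal (X.DvNode e) ∧ X.IvNode e = X.DvNode e ⊓ X.PiI) ∧
    ∀ e : X.Cusp, X.DvCusp e = Subgroup.Commensurable.commensurator (X.cuspSub e) ∧
      IsCommensurablyTerminal (X.DvCusp e)

/-- [AbsTopII] Prop 1.3 (ix) as a predicate: "Let `e` be an edge of `𝔾`. Then the image of `D_e`
in `H` is open, but `D_e` is not open in `Π_H`." [cite: MochizukiAbsTopII2013, Prop 1.3 (ix) p.12] -/
def Prop13ix : Prop :=
  haveI := X.normal_PiG
  (∀ e : X.Node, IsOpen (((X.DvNode e).map (QuotientGroup.mk' X.PiG) :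
      Subgroup (X.PiH ⧸ X.PiG)) : Set (X.PiH ⧸ X.PiG)) ∧ ¬ IsOpen (X.DvNode e : Set X.PiH)) ∧
    ∀ e : X.Cusp, IsOpen (((X.DvCusp e).map (QuotientGroup.mk' X.PiG) :
      Subgroup (X.PiH ⧸ X.PiG)) : Set (X.PiH ⧸ X.PiG)) ∧ ¬ IsOpen (X.DvCusp e : Set X.PiH)

/-- [AbsTopII] Prop 1.3 (iv), the trichotomy and its "in particular", AS PRINTED — the repaired
form of `Prop13iv` (finding F-L4t6g5-1): "Let `v, v'` be vertices of `𝔾`. If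
`D_v ∩ D_{v'} ∩ Π_I ≠ {1}`, then one of the following three [mutually exclusive] properties holds:
(1) `v = v'`; (2) `v` and `v'` are distinct, but adjacent; (3) `v` and `v'` are distinct and
non-adjacent, but there exists a vertex `v'' ≠ v, v'` of `𝔾` such that `v''` is adjacent to `v`
and `v'`. … In particular, `I_v ∩ I_{v'} ≠ {1}` implies that `v = v'`."  Since "each vertex `v`
… determines [up to conjugation in `Π_𝔾`] a subgroup `Π_v ⊆ Π_𝔾`" (Def 1.2 (ii) p. 10), the
statement is typed for ALL choices of the conjugate of `Π_{v'}`, i.e. for the `Π_𝔾`-CONJUGATES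
`γ·D_{v'}·γ⁻¹`, `γ·I_{v'}·γ⁻¹`, `γ ∈ Π_𝔾` (not `Π_H`: an element over a vertex-moving `h ∈ H`
carries `Π_{v'}` to a verticial subgroup of another vertex).  The refined clauses "for appropriate
choices of conjugates … `D_v ∩ D_{v'} ∩ Π_I = I_e`" / "`= I_{v''}`" are not typed (as before).
Cited by [IUTchI] pp. 45, 49, 50. [cite: MochizukiAbsTopII2013, Prop 1.3 (iv) p.11] -/
def Prop13iv' : Prop :=
  (∀ (v v' : X.Vert) (γ : X.PiH), γ ∈ X.PiG → X.Dv v ⊓ MulAut.conj γ • X.Dv v' ⊓ X.PiI ≠ ⊥ →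
      v = v' ∨ (v ≠ v' ∧ X.Adjacent v v') ∨
        (v ≠ v' ∧ ¬ X.Adjacent v v' ∧ ∃ v'' : X.Vert, v'' ≠ v ∧ v'' ≠ v' ∧
          X.Adjacent v v'' ∧ X.Adjacent v'' v')) ∧
    ∀ (v v' : X.Vert) (γ : X.PiH), γ ∈ X.PiG → X.Iv v ⊓ MulAut.conj γ • X.Iv v' ≠ ⊥ → v = v'

end DPSCData

end Literature.AnabelianGeometry.AbsoluteAnabelian
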